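import Literature.MathematicalPhysics.QuantumFieldTheory.Balaban1983to89.B9Eq386BondPropagatorTwoBackgroundLetterTower

/-!
# `Balaban1983to89.B9Eq386BondPropagatorTwoBackgroundGradientLetterTower` — T. Bałaban, *Propagators for lattice gauge theories in a background field*, Commun. Math. Phys. **99**
# (1985) 389–434 [Balaban1985BackgroundPropagators] (3.84)–(3.86) p. 407 *«G(U^η) = G(1)(I − V G(1))⁻¹ (3.86)»*, Thm 3.3 p. 399 (*«|G(U)f|, |∇_U G(U)f|, … ≤ B₀ … |f|»*), Thm 3.4
# p. 400 (*«… small perturbations of the operators depending on U only»*), (3.3) p. 391, Thm 3.11 p. 416: **THE GRADIENT MEMBER OF THE TWO-BACKGROUND LADDER OF THE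
# `k`-LEVEL BOND PROPAGATOR `G₁,k = Δ_{a,k}⁻¹` AT THE FLAT BASE, AS A LOCAL LETTER WITH THE SMALL FACTOR `α`, CONSTANTS BEFORE THE LATTICE** — `∃ α₀ K κ` BEFORE
# `n, η, m, U`: for every one-block source `f` over the coarse block `v`, every direction `μ` and every fine bond `b`:
# `‖(D_U((G₁,k(U) − G₁,k(1))f)_μ)(b)‖, ‖(∇_U(G₁,k(U) − G₁,k(1))f)(b, μ)‖, ‖(∇_1(G₁,k(U) − G₁,k(1))f)(b, μ)‖ ≤ K·α·e^{−κ·d_m(Π(b₊), v)}·F` — the companion of this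
# lineage's VALUE letter `B9Eq386BondPropagatorTwoBackgroundLetterTower.exists_letter_G1k_sub_flat` (gen 100), which with it forms the (value, gradient) pair the (117) socket
# `B11Eq117TransformationNormComp.norm_toCLM115_le_of_comp` consumes for a HEIGHT-FREE two-background defect

statement-level skeleton of published theorems with citation tags; proofs where landed; nothing here is a claim about the Yang–Mills mass gap

CITATION HEADER (lean-in-tree rule).  Audit cell `pub-balaban`, sub-cell `t4`, BINDER row NE9; filed by NE9 crux-team LEAF PROVER 01 (`b2b-balaban-t4-ne9-formalise-leaf-01`, gen 101;
ROUTE (J′-G) «bond storey», the gradient member; bears_on: R4/N22).  Composition BY NAME: this lineage's gen-100 `B9Eq386BondPropagatorTwoBackgroundLetterTower`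
(`exists_letter_laplaceAk_sub_flat_G1k_one` = the letter of `V·G₁,k(1)`, `exists_letter_G1k_sub_flat` = the value letter of the difference, `G1k_laplaceAk_apply`,
`laplaceAk_G1k_apply`), the OWNER lineage's `B9Eq326G1kSliceGradRowClosed.exists_local_gradLetter_G1k` (the slice-gradient MODEL row of `G₁,k(U)` — O-NE9-1, #5 UNRULED) with
its reading `B9Eq326LocalPartTowerSliceGradientRow.norm_covGrad_apply_le_of_slice`, ne9-leaf-05's `B9Eq326G1SupRowOfLetters.letter_comp`, ne9-leaf-04's
`B9Eq373TransporterLipschitzLetters.norm_adTransportW_sub_adTransportW_le` (the transporter letter `‖R(U(b))w − w‖ ≤ 2M_φM_φ′‖U(b) − 1‖‖w‖`), `B5Eq172HodgePositivity.adTransportW_one`,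
ne9-leaf-01's `B9Eq349BlockMultipliers` (block families).  Source READ first-hand in the held text layer `paper:balaban1985-cmp99-background-propagators` (journal page = PDF page + 388)
p. 407 (3.84)–(3.86), p. 399 Thm 3.3, p. 400 Thm 3.4, p. 391 (3.3).  NOTHING of print's proofs is reproduced: [folklore] resolvent identity + one letter composition + one transporter
difference.

THE PRINT (verbatim, p. 400, Thm 3.4): *«… G(U′U), … can be extended to analytic functions of A and the inequalities (3.42)–(3.46) hold for these extensions … describing these
analytic extensions as small perturbations of the operators depending on U only.»*; (3.42) p. 397 lists `|(∇_U G(U)f)(b)|` among the rows.  The cell's first-order reading at the flat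
point: `∇(G(U) − G(1))f` is `O(α)` with the same exponential letter.

WHY THIS FILE (cell context).  The (115) norm of [Balaban1985Variational] is `max{|·|_(−1), |∇·|_(−2)}`; a two-background defect `‖ι(T(U)f) − T(1)f‖_(115),∇_1` that is free of the
lattice (height `L^{n+1}` AND volume) needs BOTH the sup row of `T(U) − T(1)` and the sup row of `∇_1∘(T(U) − T(1))` (the OWNER's socket `B11Eq117TransformationNormComp`); the
fixed-lattice defects of `B11Eq117LetterDefectsTowerTwoBackgrounds` pay `M_∇ = 2|η|⁻¹` and `√(c·#)` instead.  Gen 100 landed the value member for `T := G₁,k`; this file is the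
gradient member, in all three readings a consumer may want: the slice derivative `D_U(·)_μ` at `U`, the covariant gradient `∇_U` at `U`, and the FLAT gradient `∇_1` (the reading of
the (115) norm at the flat chart).

WHAT IS PROVED (sorry-free; proof lane — 0 `def`; [folklore]).
* §1 **`exists_gradLetter_G1k_sub_flat`** — `∃ α₀ > 0, K ≥ 0, κ > 0` BEFORE the binder block of `exists_letter_G1k_sub_flat` (VERBATIM) `+ (μ : Fin d)`; conclusion: the three
  readings above, each `≤ K·α·e^{−κ·d_m(Π(b₊), v)}·F`.  MECHANISM: `G₁,k(U)f − G₁,k(1)f = −G₁,k(U)((Δ_{a,k}(U) − Δ_{a,k}(1))G₁,k(1)f)`; the inner vector has the letter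
  `K_V·α·e^{−κ_V d}` (gen 100 §1); the slice-gradient row of `G₁,k(U)` (`exists_local_gradLetter_G1k`, conjunct 1, output block `Π(b₊)`) composed with it by `letter_comp`
  (`Σ_u e^{−(δ_G−κ)d(w,u)} ≤ K_d`); `∇_U` from the slice by `norm_covGrad_apply_le_of_slice`; `∇_1 = ∇_U + η⁻¹(1 − R(U(b)))(·)(b₊)` with `‖R(U(b))w − w‖ ≤ 2M_φM_φ′αη‖w‖`
  against the VALUE letter of the difference at `b₊` (`exists_letter_G1k_sub_flat`) — the extra term is `2M_φM_φ′·K_S·α²`, absorbed by `α ≤ 1`.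
* §2 **`exists_supGrad_G1k_sub_flat`** — the GLOBAL form: `∃ α₀ K` such that for EVERY `f` with `‖f(b′)‖ ≤ F`: `‖(∇_U(G₁,k(U) − G₁,k(1))f)(b, μ)‖ ≤ K·α·F` and
  `‖(∇_1(G₁,k(U) − G₁,k(1))f)(b, μ)‖ ≤ K·α·F` (block decomposition `f = Σ_v 1_{Π⁻¹(v)}f`, `Σ_v e^{−κ d_m(u,v)} ≤ K_d(κ)`) — with gen 100's `exists_supRow_G1k_sub_flat` the
  HEIGHT-FREE pair `(M_T, M_{∇T})` of the (117) socket for `T := G₁,k(U) − G₁,k(1)` read at `∇_1`.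
HONEST SCOPE.  Composition BY NAME on the cell's MODEL rows of `G₁,k` (value + slice gradient; O-NE9-1, #5 UNRULED); constants crude (NOT print's `B₀`); first-order identity only; flat
base only; the four smallness windows of `U`, unitarity, the tower data, the positivity witnesses at `U` and at `1` stay HYPOTHESES; nothing of [B9] Thm 3.3 ∕ 3.4 asserted as printed;
«NE9 ⇐ the named binders»; NE9 NOT PRINTED ∕ NOT PROVED; spine PROVED 0∕9; rung (B)+1 on a finite T⁴ — NOT infinite volume, NOT mass gap, NOT BetaPertH, NOT Clay.  HONEST DEPENDENCY:
continuum YM on T⁴ ⇐ BetaPertH ∧ nine spine estimates (0/9 proved); BetaPertH ⇐ (D1) ∧ (D4) ∧ CAP+tail; G-an2-4 gates asym, D1 and NE2/3/4.  NEW file; nothing modified.  Net new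
unproved facts: 0.
-/

noncomputable section

open scoped InnerProductSpace ComplexConjugate BigOperators

namespace Literature.MathematicalPhysics.QuantumFieldTheory.Balaban1983to89.B9Eq386BondPropagatorTwoBackgroundGradientLetterTower

open B4Sect5Torus (TSite tdist tdist_nonneg tdist_triangle torusSum_le)
open B4Sect5Proof (latticeConst latticeConst_nonneg)
open B9SectCLatticeCarrier (Bond bpos btgt shift unshift shift_unshift)
open B9Eq311L2Pairing (WL2)
open B9Eq319QprimeTorus (blockCoord)
open B7Prop1Explicit (U1 Wcx boxVec)
open B11Eq103H1Complex (SiteL2K BondL2K covDerivL2K)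
open B9Eq33CovDerivVector (covGrad covGrad_apply)
open B9Eq310DeltaPrime (plaqHolU)
open B9Eq310HessianOperator (adTransportW)
open B9Eq315QTorus (perCfg cornerSite)
open B9Eq315QTower (towerP UlevOf)
open B9Eq315QTowerFlat (perCfg_UlevOf_one_mem_U1 norm_Wcx_UlevOf_one_sub_one_le)
open B9Eq316TowerFlatIsOneStep (towerP_eq_fineP_pow siteCast)
open B9Eq326OperatorTower (laplaceAk G1k)
open B9Eq324DeltaPrimeATower (laplacePrimeAk)
open B9Eq349BlockMultipliers (exists_block_clm_family sum_block_apply)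
open B9Eq326G1kSliceGradRowClosed (exists_local_gradLetter_G1k)
open B9Eq326LocalPartTowerSliceGradientRow (norm_covGrad_apply_le_of_slice)
open B9Eq326G1SupRowOfLetters (letter_comp)
open B9Eq373TransporterLipschitzLetters (norm_adTransportW_sub_adTransportW_le)
open B9Eq386BondPropagatorTwoBackgroundLetterTower (exists_letter_laplaceAk_sub_flat_G1k_one exists_letter_G1k_sub_flat G1k_laplaceAk_apply laplaceAk_G1k_apply)

variable {d : ℕ} (hd : 1 ≤ d) (L : ℕ) [NeZero L] (hL : 1 ≤ L) (hL3 : 3 ≤ L)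
  {𝔸 : Type*} [NormedRing 𝔸] [NormedAlgebra ℂ 𝔸] [CompleteSpace 𝔸] [NormOneClass 𝔸] [StarRing 𝔸] [NormedStarGroup 𝔸] [StarModule ℂ 𝔸] [FiniteDimensional ℂ 𝔸]
  {W : Type*} [NormedAddCommGroup W] [InnerProductSpace ℂ W] [FiniteDimensional ℂ W] (φ : W ≃ₗ[ℂ] 𝔸)
  {Mφ Mφ' : ℝ} (hMφ : 0 ≤ Mφ) (hMφ' : 0 ≤ Mφ') (hφ : ∀ w, ‖φ w‖ ≤ Mφ * ‖w‖) (hφ' : ∀ X, ‖φ.symm X‖ ≤ Mφ' * ‖X‖) (hstar : ∀ X : 𝔸, ‖star X‖ ≤ ‖X‖)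
  {a : ℝ} (ha : 0 < a) {a' : ℝ} (ha' : 0 < a') {r : ℝ} (hr0 : 0 ≤ r) (hr1 : r < 1)
  (τ : 𝔸 →ₗ[ℂ] ℂ) {Cτ : ℝ} (hτ : ∀ X, ‖τ X‖ ≤ Cτ * ‖X‖) (hCτ : 0 ≤ Cτ) {Mτ : ℝ} (hτm : ∀ X Y : 𝔸, ‖τ (X * Y)‖ ≤ Mτ * ‖X‖ * ‖Y‖) (hMτ : 0 ≤ Mτ)
  {ρw : ℝ} (hρw : 0 ≤ ρw)
  (hτ₁ : ∀ X : 𝔸, τ (star X) = conj (τ X)) (hτ₂ : ∀ X Y : 𝔸, τ (X * Y) = τ (Y * X)) (hφτ : ∀ X Y : 𝔸, ⟪φ.symm X, φ.symm Y⟫_ℂ = τ (star X * Y))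
  {ι : Type} [Fintype ι] [DecidableEq ι] (b : Module.Basis ι ℝ 𝔸) {M₂ : ℝ} (hM₂ : 0 ≤ M₂) (hrepr : ∀ (v : 𝔸) (i : ι), |b.repr v i| ≤ M₂ * ‖v‖)
  (AQ : ℝ)

/-! ## §1 The local gradient letter of `G₁,k(U) − G₁,k(1)` in the three readings -/

include hd hL hL3 hMφ hMφ' hφ hφ' hstar ha ha' hr0 hr1 hτ hCτ hτm hMτ hρw hτ₁ hτ₂ hφτ hM₂ hrepr in
set_option maxHeartbeats 3200000 in
/-- **THE GRADIENT MEMBER OF THE TWO-BACKGROUND LADDER OF `G₁,k` AT THE FLAT BASE, AS A LOCAL LETTER WITH THE SMALL FACTOR `α`, CONSTANTS BEFORE THE LATTICE** — see the module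
docstring: for one-block sources `f` over `v`, the slice derivative `D_U(·)_μ`, the covariant gradient `∇_U` and the flat gradient `∇_1` of `G₁,k(U)f − G₁,k(1)f` at `b` are
`≤ K·α·e^{−κ·d_m(Π(b₊), v)}·F`. [folklore] [cite: Balaban1985BackgroundPropagators, (3.84)–(3.86) p.407, Thm 3.3 p.399, Thm 3.4 p.400, (3.3) p.391, Thm 3.11 p.416] -/
theorem exists_gradLetter_G1k_sub_flat :
    ∃ α₀ K κ : ℝ, 0 < α₀ ∧ 0 ≤ K ∧ 0 < κ ∧
      ∀ (n : ℕ) (η : ℝ), η * (L : ℝ) ^ (n + 1) = 1 →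
      ∀ (c₀ c₁ : ℝ) [Fact (0 < c₀)] [Fact (0 < c₁)], c₀ * ((L : ℝ) ^ (n + 1)) ^ d = c₁ → |η| ^ d / c₀ ≤ ρw →
      ∀ (m : Fin d → ℕ) [∀ i, NeZero (m i)], (∀ i, 1 ≤ m i) → ∀ (U : Bond d (towerP L m (n + 1)) → 𝔸ˣ) (α : ℝ), 0 ≤ α → α ≤ α₀ →
        (∀ bd, U bd ∈ U1 𝔸) → (∀ bd, ‖(U bd : 𝔸) - 1‖ ≤ α * η) →
        (∀ (x : TSite d (towerP L m (n + 1))) (μ ν : Fin d), ‖(U (shift ν x, μ) : 𝔸) - (U (x, μ) : 𝔸)‖ ≤ α * η ^ 2) →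
        (∀ p : B9SectCLatticeCarrier.Plaq d (towerP L m (n + 1)), ‖(plaqHolU U p : 𝔸) - 1‖ ≤ α * η ^ 2) →
      ∀ (hUst : ∀ bd, star (U bd : 𝔸) = (((U bd)⁻¹ : 𝔸ˣ) : 𝔸))
        (αU : ℕ → ℝ), (∀ j, 0 ≤ αU j) → ∀ (hα1 : ∀ j, αU j ≤ 1 / 64), (∑ j ∈ Finset.range (n + 1), αU j ≤ AQ) →
        ∀ (hU1 : ∀ (j : ℕ) (x : B7Prop1Explicit.Site d) (k : Fin d), perCfg (towerP L m (j + 1)) (UlevOf L m (n + 1) U j) x k ∈ U1 𝔸)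
        (hreg : ∀ (j : ℕ) (y : TSite d (towerP L m j)) (k : Fin d) (ρ' : Fin d → Fin L),
          ‖((Wcx L (perCfg (towerP L m (j + 1)) (UlevOf L m (n + 1) U j)) (cornerSite L y) k (boxVec L ρ') : 𝔸ˣ) : 𝔸) - 1‖ ≤ αU j),
      ∀ (εU : ℕ → ℝ), (∀ j, 0 ≤ εU j) → (∀ j, εU j ≤ 1) → (∀ j < n + 1, εU j ≤ α * r ^ j) →
        (∀ (j : ℕ) (bd : Bond d (towerP L m (j + 1))), ‖(UlevOf L m (n + 1) U j bd : 𝔸) - 1‖ ≤ εU j) →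
        (∀ (j : ℕ) (bd : Bond d (towerP L m (j + 1))), UlevOf L m (n + 1) U j bd ∈ U1 𝔸) →
        (∀ (j : ℕ) (bd : Bond d (towerP L m (j + 1))) (w : W), ‖adTransportW φ (UlevOf L m (n + 1) U j) bd w‖ ≤ ‖w‖) →
      ∀ (hposU' : ∀ x : SiteL2K ℂ d (towerP L m (n + 1)) c₀ W, x ≠ 0 → 0 < RCLike.re ⟪x, laplacePrimeAk L m n φ η U a' (c₁ := c₁) x⟫_ℂ)
        (hposU : ∀ x : BondL2K ℂ d (towerP L m (n + 1)) c₀ W, x ≠ 0 →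
          0 < RCLike.re ⟪x, laplaceAk L m n φ η U hL αU hα1 hU1 hreg τ (c₀ := c₀) (c₁ := c₁) a x⟫_ℂ)
        (hpos'₁ : ∀ x : SiteL2K ℂ d (towerP L m (n + 1)) c₀ W, x ≠ 0 →
          0 < RCLike.re ⟪x, laplacePrimeAk L m n φ η (fun _ : Bond d (towerP L m (n + 1)) => (1 : 𝔸ˣ)) a' (c₁ := c₁) x⟫_ℂ)
        (hpos₁ : ∀ x : BondL2K ℂ d (towerP L m (n + 1)) c₀ W, x ≠ 0 →
          0 < RCLike.re ⟪x, laplaceAk L m n φ η (fun _ : Bond d (towerP L m (n + 1)) => (1 : 𝔸ˣ)) hL (fun _ => 0) (fun _ => by norm_num)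
            (perCfg_UlevOf_one_mem_U1 L m (n + 1)) (norm_Wcx_UlevOf_one_sub_one_le L m (n + 1) (fun _ => 0) (fun _ => le_rfl)) τ
            (c₀ := c₀) (c₁ := c₁) a x⟫_ℂ),
      ∀ (v : TSite d m) (f : BondL2K ℂ d (towerP L m (n + 1)) c₀ W) (F : ℝ),
        (∀ b', blockCoord (L ^ (n + 1)) m (siteCast (towerP_eq_fineP_pow L m (n + 1)) (bpos b')) ≠ v →
          WL2.equiv ℂ (fun _ : Bond d (towerP L m (n + 1)) => c₀) W f b' = 0) →
        (∀ b', ‖WL2.equiv ℂ (fun _ : Bond d (towerP L m (n + 1)) => c₀) W f b'‖ ≤ F) →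
      ∀ (μ : Fin d) (bd : Bond d (towerP L m (n + 1))),
        ‖WL2.equiv ℂ (fun _ : Bond d (towerP L m (n + 1)) => c₀) W
            (covDerivL2K ℂ c₀ ((η : ℂ))⁻¹ (adTransportW φ U)
              ((WL2.equiv ℂ (fun _ : TSite d (towerP L m (n + 1)) => c₀) W).symm fun y =>
                WL2.equiv ℂ (fun _ : Bond d (towerP L m (n + 1)) => c₀) W
                  (G1k L m n φ η U hL αU hα1 hU1 hreg τ (c₀ := c₀) (c₁ := c₁) hposU f -
                    G1k L m n φ η (fun _ : Bond d (towerP L m (n + 1)) => (1 : 𝔸ˣ)) hL (fun _ => 0) (fun _ => by norm_num)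
                      (perCfg_UlevOf_one_mem_U1 L m (n + 1)) (norm_Wcx_UlevOf_one_sub_one_le L m (n + 1) (fun _ => 0) (fun _ => le_rfl)) τ
                      (c₀ := c₀) (c₁ := c₁) hpos₁ f) (y, μ))) bd‖ ≤
          K * α * Real.exp (-(κ * tdist m (blockCoord (L ^ (n + 1)) m (siteCast (towerP_eq_fineP_pow L m (n + 1)) (btgt bd))) v)) * F ∧
        ‖covGrad ((η : ℂ))⁻¹ (adTransportW φ U)
            (WL2.equiv ℂ (fun _ : Bond d (towerP L m (n + 1)) => c₀) W
              (G1k L m n φ η U hL αU hα1 hU1 hreg τ (c₀ := c₀) (c₁ := c₁) hposU f -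
                G1k L m n φ η (fun _ : Bond d (towerP L m (n + 1)) => (1 : 𝔸ˣ)) hL (fun _ => 0) (fun _ => by norm_num)
                  (perCfg_UlevOf_one_mem_U1 L m (n + 1)) (norm_Wcx_UlevOf_one_sub_one_le L m (n + 1) (fun _ => 0) (fun _ => le_rfl)) τ
                  (c₀ := c₀) (c₁ := c₁) hpos₁ f)) (bd, μ)‖ ≤
          K * α * Real.exp (-(κ * tdist m (blockCoord (L ^ (n + 1)) m (siteCast (towerP_eq_fineP_pow L m (n + 1)) (btgt bd))) v)) * F ∧
        ‖covGrad ((η : ℂ))⁻¹ (adTransportW φ (fun _ : Bond d (towerP L m (n + 1)) => (1 : 𝔸ˣ)))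
            (WL2.equiv ℂ (fun _ : Bond d (towerP L m (n + 1)) => c₀) W
              (G1k L m n φ η U hL αU hα1 hU1 hreg τ (c₀ := c₀) (c₁ := c₁) hposU f -
                G1k L m n φ η (fun _ : Bond d (towerP L m (n + 1)) => (1 : 𝔸ˣ)) hL (fun _ => 0) (fun _ => by norm_num)
                  (perCfg_UlevOf_one_mem_U1 L m (n + 1)) (norm_Wcx_UlevOf_one_sub_one_le L m (n + 1) (fun _ => 0) (fun _ => le_rfl)) τ
                  (c₀ := c₀) (c₁ := c₁) hpos₁ f)) (bd, μ)‖ ≤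
          K * α * Real.exp (-(κ * tdist m (blockCoord (L ^ (n + 1)) m (siteCast (towerP_eq_fineP_pow L m (n + 1)) (btgt bd))) v)) * F := by
  classical
  obtain ⟨αV, KV, κV, hαV, hKV, hκV, HV⟩ :=
    exists_letter_laplaceAk_sub_flat_G1k_one hd L hL hL3 φ hMφ hMφ' hφ hφ' hstar ha ha' hr0 hr1 τ hτ hCτ hτm hMτ hρw hτ₁ hτ₂ hφτ b hM₂ hrepr AQ
  obtain ⟨αG, BG, δG, hαG, hBG, hδG, GROW⟩ :=
    exists_local_gradLetter_G1k hd L hL hL3 φ hMφ hMφ' hφ hφ' hstar ha ha' (ϱ := r) hr0 hr1 τ hτ hCτ hτm hMτ hρw hτ₁ hτ₂ hφτ AQ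
  obtain ⟨αS, KS, κS, hαS, hKS, hκS, HS⟩ :=
    exists_letter_G1k_sub_flat hd L hL hL3 φ hMφ hMφ' hφ hφ' hstar ha ha' hr0 hr1 τ hτ hCτ hτm hMτ hρw hτ₁ hτ₂ hφτ b hM₂ hrepr AQ
  set κf : ℝ := min (min κV δG) κS / 2 with hκf
  have hmin0 : 0 < min (min κV δG) κS := lt_min (lt_min hκV hδG) hκS
  have hκf0 : 0 < κf := by positivity
  have hm1 : min (min κV δG) κS ≤ κV := (min_le_left _ _).trans (min_le_left _ _)
  have hm2 : min (min κV δG) κS ≤ δG := (min_le_left _ _).trans (min_le_right _ _)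
  have hm3 : min (min κV δG) κS ≤ κS := min_le_right _ _
  have hκfV : κf ≤ κV := by rw [hκf]; linarith
  have hκfS : κf ≤ κS := by rw [hκf]; linarith
  have hrate : 0 < δG - κf := by rw [hκf]; linarith
  set S : ℝ := latticeConst d (δG - κf) with hS
  have hS0 : 0 ≤ S := latticeConst_nonneg d hrate.le
  refine ⟨min (min αV αG) (min αS 1), KV * BG * S + 2 * Mφ * Mφ' * KS, κf, lt_min (lt_min hαV hαG) (lt_min hαS one_pos), by positivity, hκf0, ?_⟩
  intro n η hηL c₀ c₁ _ _ hw hρ m _ hm U α hα hαle hUb hUη hUw hpl hUst αU hα0U hα1 hAQ hU1 hreg εU hε0 hε1 hεr hlev hlev1 hRlev hposU' hposU hpos'₁ hpos₁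
    v f F hfv hfF μ bd
  have hαV' : α ≤ αV := hαle.trans ((min_le_left _ _).trans (min_le_left _ _))
  have hαG' : α ≤ αG := hαle.trans ((min_le_left _ _).trans (min_le_right _ _))
  have hαS' : α ≤ αS := hαle.trans ((min_le_right _ _).trans (min_le_left _ _))
  have hα1' : α ≤ 1 := hαle.trans ((min_le_right _ _).trans (min_le_right _ _))
  have hF : 0 ≤ F := (norm_nonneg _).trans (hfF bd)
  haveI : Nonempty (Bond d (towerP L m (n + 1))) := ⟨bd⟩
  -- lattice facts
  have hLpos : (0 : ℝ) < (L : ℝ) ^ (n + 1) := pow_pos (by exact_mod_cast Nat.pos_of_ne_zero (NeZero.ne L)) _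
  have hη : 0 < η := by
    by_contra h; push Not at h; nlinarith [mul_nonpos_of_nonpos_of_nonneg h hLpos.le]
  have hcn : ‖((η : ℂ))⁻¹‖ = η⁻¹ := by rw [norm_inv, Complex.norm_real, Real.norm_eq_abs, abs_of_pos hη]
  have hUgrad : ∀ (x : TSite d (towerP L m (n + 1))) (μ : Fin d), ‖(U (x, μ) : 𝔸) - U (unshift μ x, μ)‖ ≤ α * η ^ 2 := fun x μ => by
    have h := hUw (unshift μ x) μ μ
    rwa [shift_unshift] at h
  have hUb1 : ∀ bd : Bond d (towerP L m (n + 1)), (fun _ : Bond d (towerP L m (n + 1)) => (1 : 𝔸ˣ)) bd ∈ U1 𝔸 := fun _ => one_mem _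
  -- names
  set piB : Bond d (towerP L m (n + 1)) → TSite d m := fun b' => blockCoord (L ^ (n + 1)) m (siteCast (towerP_eq_fineP_pow L m (n + 1)) (bpos b')) with hpiB
  set piT : Bond d (towerP L m (n + 1)) → TSite d m := fun b' => blockCoord (L ^ (n + 1)) m (siteCast (towerP_eq_fineP_pow L m (n + 1)) (btgt b')) with hpiT
  set G1 := G1k L m n φ η (fun _ : Bond d (towerP L m (n + 1)) => (1 : 𝔸ˣ)) hL (fun _ => 0) (fun _ => by norm_num)
    (perCfg_UlevOf_one_mem_U1 L m (n + 1)) (norm_Wcx_UlevOf_one_sub_one_le L m (n + 1) (fun _ => 0) (fun _ => le_rfl)) τ (c₀ := c₀) (c₁ := c₁) hpos₁ with hG1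
  set GU := G1k L m n φ η U hL αU hα1 hU1 hreg τ (c₀ := c₀) (c₁ := c₁) hposU with hGU
  set ΔU := laplaceAk L m n φ η U hL αU hα1 hU1 hreg τ (c₀ := c₀) (c₁ := c₁) a with hΔU
  set Δ1 := laplaceAk L m n φ η (fun _ : Bond d (towerP L m (n + 1)) => (1 : 𝔸ˣ)) hL (fun _ => 0) (fun _ => by norm_num)
    (perCfg_UlevOf_one_mem_U1 L m (n + 1)) (norm_Wcx_UlevOf_one_sub_one_le L m (n + 1) (fun _ => 0) (fun _ => le_rfl)) τ (c₀ := c₀) (c₁ := c₁) a with hΔ1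
  set E : ℝ := Real.exp (-(κf * tdist m (piT bd) v)) with hE
  obtain ⟨TV, hTV⟩ : ∃ T : BondL2K ℂ d (towerP L m (n + 1)) c₀ W →L[ℂ] BondL2K ℂ d (towerP L m (n + 1)) c₀ W,
      T = LinearMap.toContinuousLinearMap ((ΔU - Δ1) ∘ₗ G1) := ⟨_, rfl⟩
  obtain ⟨TG, hTG⟩ : ∃ T : BondL2K ℂ d (towerP L m (n + 1)) c₀ W →L[ℂ] BondL2K ℂ d (towerP L m (n + 1)) c₀ W,
      T = LinearMap.toContinuousLinearMap GU := ⟨_, rfl⟩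
  -- the slice derivative `u ↦ D_U u_μ` as a CLM of the bond carrier
  obtain ⟨Dcl, hDcl⟩ : ∃ T : BondL2K ℂ d (towerP L m (n + 1)) c₀ W →L[ℂ] BondL2K ℂ d (towerP L m (n + 1)) c₀ W,
      ∀ (u : BondL2K ℂ d (towerP L m (n + 1)) c₀ W) (b' : Bond d (towerP L m (n + 1))),
        WL2.equiv ℂ (fun _ : Bond d (towerP L m (n + 1)) => c₀) W (T u) b' =
          WL2.equiv ℂ (fun _ : Bond d (towerP L m (n + 1)) => c₀) W (covDerivL2K ℂ c₀ ((η : ℂ))⁻¹ (adTransportW φ U)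
            ((WL2.equiv ℂ (fun _ : TSite d (towerP L m (n + 1)) => c₀) W).symm fun y =>
              WL2.equiv ℂ (fun _ : Bond d (towerP L m (n + 1)) => c₀) W u (y, μ))) b' :=
    ⟨LinearMap.toContinuousLinearMap (covDerivL2K ℂ c₀ ((η : ℂ))⁻¹ (adTransportW φ U) ∘ₗ
        (WL2.linearEquiv ℂ ℂ (fun _ : TSite d (towerP L m (n + 1)) => c₀)).symm.toLinearMap ∘ₗ
        LinearMap.funLeft ℂ W (fun y : TSite d (towerP L m (n + 1)) => ((y, μ) : Bond d (towerP L m (n + 1)))) ∘ₗ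
        (WL2.linearEquiv ℂ ℂ (fun _ : Bond d (towerP L m (n + 1)) => c₀)).toLinearMap), fun _ _ => rfl⟩
  -- (1) the letter of `V G₁,k(1)` (gen 100 §1) and the slice-gradient row of `G₁,k(U)` (MODEL row at `U`), post-composed
  have hLV : ∀ (v : TSite d m) (f : BondL2K ℂ d (towerP L m (n + 1)) c₀ W) (F : ℝ), (∀ x, piB x ≠ v → WL2.equiv ℂ (fun _ : Bond d (towerP L m (n + 1)) => c₀) W f x = 0) →
      (∀ x, ‖WL2.equiv ℂ (fun _ : Bond d (towerP L m (n + 1)) => c₀) W f x‖ ≤ F) →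
      ∀ b', ‖WL2.equiv ℂ (fun _ : Bond d (towerP L m (n + 1)) => c₀) W (TV f) b'‖ ≤ (KV * α) * Real.exp (-(κV * tdist m (piB b') v)) * F := by
    intro v f F hfv hfF b'
    rw [hTV, LinearMap.coe_toContinuousLinearMap', LinearMap.comp_apply, LinearMap.sub_apply]
    exact HV n η hηL c₀ c₁ hw hρ m hm U α hα hαV' hUb hUη hUw hpl hUst αU hα0U hα1 hAQ hU1 hreg εU hε0 hε1 hεr hlev hlev1 hRlev hposU' hpos'₁ hpos₁ v f F hfv hfF b'
  have hLD : ∀ (v : TSite d m) (g : BondL2K ℂ d (towerP L m (n + 1)) c₀ W) (F : ℝ), (∀ x, piB x ≠ v → WL2.equiv ℂ (fun _ : Bond d (towerP L m (n + 1)) => c₀) W g x = 0) →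
      (∀ x, ‖WL2.equiv ℂ (fun _ : Bond d (towerP L m (n + 1)) => c₀) W g x‖ ≤ F) →
      ∀ b', ‖WL2.equiv ℂ (fun _ : Bond d (towerP L m (n + 1)) => c₀) W ((Dcl ∘L TG) g) b'‖ ≤ BG * Real.exp (-(δG * tdist m (piT b') v)) * F := by
    intro v g F hgv hgF b'
    rw [ContinuousLinearMap.comp_apply, hDcl, hTG, LinearMap.coe_toContinuousLinearMap']
    exact (GROW n η hηL c₀ c₁ hw hρ m hm U αU hα0U hα1 hU1 hreg εU hε0 hlev hlev1 α hα hαG' hUst hUb hUη hpl hUgrad hRlev hεr hAQ hposU' hposU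
      v g F hgv hgF μ b').1
  -- (2) the composition over the unit lattice
  have hrow : ∀ w : TSite d m, ∑ u, Real.exp (-((δG - κf) * tdist m w u)) ≤ S := fun w => torusSum_le d hm hrate w
  have hδ0 : ∀ u v : TSite d m, 0 ≤ tdist m u v := fun u v => tdist_nonneg _ _ _
  have hδt : ∀ u y v : TSite d m, tdist m u v ≤ tdist m u y + tdist m y v := fun u y v => tdist_triangle hm u y v
  have hC := letter_comp (𝕜 := ℂ) (tdist m) piB piB piT TV (Dcl ∘L TG) hδ0 hδt (mul_nonneg hKV hα) hBG hκf0.le hκfV hLV hLD hrow v f F hfv hfF bd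
  -- (3) the resolvent identity `G(1)f − G(U)f = G(U)((Δ(U) − Δ(1))G(1)f)`
  have e1 : Δ1 (G1 f) = f := laplaceAk_G1k_apply L hL φ τ n η m _ _ _ _ _ hpos₁ f
  have e2 : GU (ΔU (G1 f)) = G1 f := G1k_laplaceAk_apply L hL φ τ n η m U αU hα1 hU1 hreg hposU (G1 f)
  have hid : G1 f - GU f = (TG ∘L TV) f := by
    rw [hTG, hTV]
    simp only [ContinuousLinearMap.coe_comp, Function.comp_apply, LinearMap.coe_toContinuousLinearMap', LinearMap.comp_apply, LinearMap.sub_apply, map_sub]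
    rw [e2, e1]
  have hid' : GU f - G1 f = -((TG ∘L TV) f) := by rw [← hid, neg_sub]
  -- (i) the slice derivative at `U`
  have hi : ‖WL2.equiv ℂ (fun _ : Bond d (towerP L m (n + 1)) => c₀) W
        (covDerivL2K ℂ c₀ ((η : ℂ))⁻¹ (adTransportW φ U)
          ((WL2.equiv ℂ (fun _ : TSite d (towerP L m (n + 1)) => c₀) W).symm fun y =>
            WL2.equiv ℂ (fun _ : Bond d (towerP L m (n + 1)) => c₀) W (GU f - G1 f) (y, μ))) bd‖ ≤ KV * BG * S * α * E * F := by
    rw [← hDcl (GU f - G1 f) bd, hid', map_neg]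
    rw [show WL2.equiv ℂ (fun _ : Bond d (towerP L m (n + 1)) => c₀) W (-(Dcl ((TG ∘L TV) f))) bd =
      -(WL2.equiv ℂ (fun _ : Bond d (towerP L m (n + 1)) => c₀) W (Dcl ((TG ∘L TV) f)) bd) from rfl, norm_neg]
    have hC' : ‖WL2.equiv ℂ (fun _ : Bond d (towerP L m (n + 1)) => c₀) W (Dcl ((TG ∘L TV) f)) bd‖ ≤ KV * α * BG * S * E * F := by
      simpa only [ContinuousLinearMap.comp_apply] using hC
    exact hC'.trans (le_of_eq (by ring))
  -- (ii) the covariant gradient at `U`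
  have hii : ‖covGrad ((η : ℂ))⁻¹ (adTransportW φ U) (WL2.equiv ℂ (fun _ : Bond d (towerP L m (n + 1)) => c₀) W (GU f - G1 f)) (bd, μ)‖ ≤
      KV * BG * S * α * E * F := norm_covGrad_apply_le_of_slice _ _ _ bd μ hi
  -- (iii) the flat gradient: `∇_1 = ∇_U + η⁻¹(1 − R(U(b)))(·)(b₊)` against the value letter of the difference at `b₊`
  set A : Bond d (towerP L m (n + 1)) → W := WL2.equiv ℂ (fun _ : Bond d (towerP L m (n + 1)) => c₀) W (GU f - G1 f) with hA
  have hval : ‖A (btgt bd, μ)‖ ≤ KS * α * E * F := by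
    have h := HS n η hηL c₀ c₁ hw hρ m hm U α hα hαS' hUb hUη hUw hpl hUst αU hα0U hα1 hAQ hU1 hreg εU hε0 hε1 hεr hlev hlev1 hRlev hposU' hposU hpos'₁ hpos₁
      v f F hfv hfF (btgt bd, μ)
    refine h.trans (mul_le_mul_of_nonneg_right (mul_le_mul_of_nonneg_left (Real.exp_le_exp.2 ?_) (mul_nonneg hKS hα)) hF)
    have ht := hδ0 (piT bd) v
    show -(κS * tdist m (piT bd) v) ≤ -(κf * tdist m (piT bd) v)
    nlinarith [mul_le_mul_of_nonneg_right hκfS ht]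
  have hRε : ∀ w : W, ‖adTransportW φ U bd w - w‖ ≤ 2 * Mφ * Mφ' * (α * η) * ‖w‖ := fun w => by
    have h := norm_adTransportW_sub_adTransportW_le φ hφ hφ' hMφ' U (fun _ : Bond d (towerP L m (n + 1)) => (1 : 𝔸ˣ)) bd bd (hUb bd) (hUb1 bd) w
    rw [B5Eq172HodgePositivity.adTransportW_one, LinearMap.id_apply, Units.val_one] at h
    exact h.trans (by gcongr; exact hUη bd)
  have e3 : covGrad ((η : ℂ))⁻¹ (adTransportW φ (fun _ : Bond d (towerP L m (n + 1)) => (1 : 𝔸ˣ))) A (bd, μ) =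
      covGrad ((η : ℂ))⁻¹ (adTransportW φ U) A (bd, μ) + ((η : ℂ))⁻¹ • (A (btgt bd, μ) - adTransportW φ U bd (A (btgt bd, μ))) := by
    rw [covGrad_apply, covGrad_apply, B5Eq172HodgePositivity.adTransportW_one, LinearMap.id_apply, ← smul_add]
    congr 1
    abel
  have hiii : ‖covGrad ((η : ℂ))⁻¹ (adTransportW φ (fun _ : Bond d (towerP L m (n + 1)) => (1 : 𝔸ˣ))) A (bd, μ)‖ ≤
      (KV * BG * S + 2 * Mφ * Mφ' * KS) * α * E * F := by
    rw [e3]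
    refine (norm_add_le _ _).trans ?_
    have hcorr : ‖((η : ℂ))⁻¹ • (A (btgt bd, μ) - adTransportW φ U bd (A (btgt bd, μ)))‖ ≤ 2 * Mφ * Mφ' * KS * α * E * F := by
      rw [norm_smul, hcn, norm_sub_rev]
      calc η⁻¹ * ‖adTransportW φ U bd (A (btgt bd, μ)) - A (btgt bd, μ)‖
          ≤ η⁻¹ * (2 * Mφ * Mφ' * (α * η) * (KS * α * E * F)) := by
            refine mul_le_mul_of_nonneg_left ((hRε _).trans ?_) (inv_nonneg.2 hη.le)
            exact mul_le_mul_of_nonneg_left hval (by positivity)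
        _ = 2 * Mφ * Mφ' * KS * (α * α) * E * F * (η⁻¹ * η) := by ring
        _ ≤ 2 * Mφ * Mφ' * KS * α * E * F * 1 := by
            rw [inv_mul_cancel₀ hη.ne']
            have hαα : α * α ≤ α := by nlinarith
            have hE0 : 0 ≤ E := Real.exp_nonneg _
            gcongr
        _ = 2 * Mφ * Mφ' * KS * α * E * F := by ring
    calc ‖covGrad ((η : ℂ))⁻¹ (adTransportW φ U) A (bd, μ)‖ + ‖((η : ℂ))⁻¹ • (A (btgt bd, μ) - adTransportW φ U bd (A (btgt bd, μ)))‖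
        ≤ KV * BG * S * α * E * F + 2 * Mφ * Mφ' * KS * α * E * F := add_le_add hii hcorr
      _ = (KV * BG * S + 2 * Mφ * Mφ' * KS) * α * E * F := by ring
  -- the three conjuncts against the common constant
  have hKle : KV * BG * S * α * E * F ≤ (KV * BG * S + 2 * Mφ * Mφ' * KS) * α * E * F := by
    have hE0 : 0 ≤ E := Real.exp_nonneg _
    have : 0 ≤ 2 * Mφ * Mφ' * KS * α * E * F := by positivity
    nlinarith
  exact ⟨hi.trans hKle, hii.trans hKle, hiii⟩

/-! ## §2 The global form: the sup rows of `∇_U(G₁,k(U) − G₁,k(1))` and `∇_1(G₁,k(U) − G₁,k(1))`, lattice-free -/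

include hd hL hL3 hMφ hMφ' hφ hφ' hstar ha ha' hr0 hr1 hτ hCτ hτm hMτ hρw hτ₁ hτ₂ hφτ hM₂ hrepr in
set_option maxHeartbeats 3200000 in
/-- **THE GRADIENT SUP ROWS OF `G₁,k(U) − G₁,k(1)`, LATTICE-FREE** — `∃ α₀ > 0, K ≥ 0` BEFORE `n, η, m, U`: along the class of the bond storey and for EVERY `f` of the fine bond
carrier with `‖f(b′)‖ ≤ F`, every `μ`, `b`: `‖(∇_U(G₁,k(U)f − G₁,k(1)f))(b, μ)‖ ≤ K·α·F` and `‖(∇_1(G₁,k(U)f − G₁,k(1)f))(b, μ)‖ ≤ K·α·F` (§1 summed over the source blocks,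
`Σ_v e^{−κ d_m(u,v)} ≤ K_d(κ)`): with gen 100's value row, the height-free pair of letters of the (117) socket for `G₁,k(U) − G₁,k(1)`. [folklore]
[cite: Balaban1985BackgroundPropagators, Thm 3.4 p.400, Thm 3.3 p.399, (3.47) p.398, (3.84)–(3.86) p.407; Balaban1985Variational, (117) p.295] -/
theorem exists_supGrad_G1k_sub_flat :
    ∃ α₀ K : ℝ, 0 < α₀ ∧ 0 ≤ K ∧
      ∀ (n : ℕ) (η : ℝ), η * (L : ℝ) ^ (n + 1) = 1 →
      ∀ (c₀ c₁ : ℝ) [Fact (0 < c₀)] [Fact (0 < c₁)], c₀ * ((L : ℝ) ^ (n + 1)) ^ d = c₁ → |η| ^ d / c₀ ≤ ρw →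
      ∀ (m : Fin d → ℕ) [∀ i, NeZero (m i)], (∀ i, 1 ≤ m i) → ∀ (U : Bond d (towerP L m (n + 1)) → 𝔸ˣ) (α : ℝ), 0 ≤ α → α ≤ α₀ →
        (∀ bd, U bd ∈ U1 𝔸) → (∀ bd, ‖(U bd : 𝔸) - 1‖ ≤ α * η) →
        (∀ (x : TSite d (towerP L m (n + 1))) (μ ν : Fin d), ‖(U (shift ν x, μ) : 𝔸) - (U (x, μ) : 𝔸)‖ ≤ α * η ^ 2) →
        (∀ p : B9SectCLatticeCarrier.Plaq d (towerP L m (n + 1)), ‖(plaqHolU U p : 𝔸) - 1‖ ≤ α * η ^ 2) →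
      ∀ (hUst : ∀ bd, star (U bd : 𝔸) = (((U bd)⁻¹ : 𝔸ˣ) : 𝔸))
        (αU : ℕ → ℝ), (∀ j, 0 ≤ αU j) → ∀ (hα1 : ∀ j, αU j ≤ 1 / 64), (∑ j ∈ Finset.range (n + 1), αU j ≤ AQ) →
        ∀ (hU1 : ∀ (j : ℕ) (x : B7Prop1Explicit.Site d) (k : Fin d), perCfg (towerP L m (j + 1)) (UlevOf L m (n + 1) U j) x k ∈ U1 𝔸)
        (hreg : ∀ (j : ℕ) (y : TSite d (towerP L m j)) (k : Fin d) (ρ' : Fin d → Fin L),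
          ‖((Wcx L (perCfg (towerP L m (j + 1)) (UlevOf L m (n + 1) U j)) (cornerSite L y) k (boxVec L ρ') : 𝔸ˣ) : 𝔸) - 1‖ ≤ αU j),
      ∀ (εU : ℕ → ℝ), (∀ j, 0 ≤ εU j) → (∀ j, εU j ≤ 1) → (∀ j < n + 1, εU j ≤ α * r ^ j) →
        (∀ (j : ℕ) (bd : Bond d (towerP L m (j + 1))), ‖(UlevOf L m (n + 1) U j bd : 𝔸) - 1‖ ≤ εU j) →
        (∀ (j : ℕ) (bd : Bond d (towerP L m (j + 1))), UlevOf L m (n + 1) U j bd ∈ U1 𝔸) →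
        (∀ (j : ℕ) (bd : Bond d (towerP L m (j + 1))) (w : W), ‖adTransportW φ (UlevOf L m (n + 1) U j) bd w‖ ≤ ‖w‖) →
      ∀ (hposU' : ∀ x : SiteL2K ℂ d (towerP L m (n + 1)) c₀ W, x ≠ 0 → 0 < RCLike.re ⟪x, laplacePrimeAk L m n φ η U a' (c₁ := c₁) x⟫_ℂ)
        (hposU : ∀ x : BondL2K ℂ d (towerP L m (n + 1)) c₀ W, x ≠ 0 →
          0 < RCLike.re ⟪x, laplaceAk L m n φ η U hL αU hα1 hU1 hreg τ (c₀ := c₀) (c₁ := c₁) a x⟫_ℂ)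
        (hpos'₁ : ∀ x : SiteL2K ℂ d (towerP L m (n + 1)) c₀ W, x ≠ 0 →
          0 < RCLike.re ⟪x, laplacePrimeAk L m n φ η (fun _ : Bond d (towerP L m (n + 1)) => (1 : 𝔸ˣ)) a' (c₁ := c₁) x⟫_ℂ)
        (hpos₁ : ∀ x : BondL2K ℂ d (towerP L m (n + 1)) c₀ W, x ≠ 0 →
          0 < RCLike.re ⟪x, laplaceAk L m n φ η (fun _ : Bond d (towerP L m (n + 1)) => (1 : 𝔸ˣ)) hL (fun _ => 0) (fun _ => by norm_num)
            (perCfg_UlevOf_one_mem_U1 L m (n + 1)) (norm_Wcx_UlevOf_one_sub_one_le L m (n + 1) (fun _ => 0) (fun _ => le_rfl)) τ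
            (c₀ := c₀) (c₁ := c₁) a x⟫_ℂ)
        (f : BondL2K ℂ d (towerP L m (n + 1)) c₀ W) (F : ℝ), (∀ b', ‖WL2.equiv ℂ (fun _ : Bond d (towerP L m (n + 1)) => c₀) W f b'‖ ≤ F) →
      ∀ (μ : Fin d) (bd : Bond d (towerP L m (n + 1))),
        ‖covGrad ((η : ℂ))⁻¹ (adTransportW φ U)
            (WL2.equiv ℂ (fun _ : Bond d (towerP L m (n + 1)) => c₀) W
              (G1k L m n φ η U hL αU hα1 hU1 hreg τ (c₀ := c₀) (c₁ := c₁) hposU f -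
                G1k L m n φ η (fun _ : Bond d (towerP L m (n + 1)) => (1 : 𝔸ˣ)) hL (fun _ => 0) (fun _ => by norm_num)
                  (perCfg_UlevOf_one_mem_U1 L m (n + 1)) (norm_Wcx_UlevOf_one_sub_one_le L m (n + 1) (fun _ => 0) (fun _ => le_rfl)) τ
                  (c₀ := c₀) (c₁ := c₁) hpos₁ f)) (bd, μ)‖ ≤ K * α * F ∧
        ‖covGrad ((η : ℂ))⁻¹ (adTransportW φ (fun _ : Bond d (towerP L m (n + 1)) => (1 : 𝔸ˣ)))
            (WL2.equiv ℂ (fun _ : Bond d (towerP L m (n + 1)) => c₀) W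
              (G1k L m n φ η U hL αU hα1 hU1 hreg τ (c₀ := c₀) (c₁ := c₁) hposU f -
                G1k L m n φ η (fun _ : Bond d (towerP L m (n + 1)) => (1 : 𝔸ˣ)) hL (fun _ => 0) (fun _ => by norm_num)
                  (perCfg_UlevOf_one_mem_U1 L m (n + 1)) (norm_Wcx_UlevOf_one_sub_one_le L m (n + 1) (fun _ => 0) (fun _ => le_rfl)) τ
                  (c₀ := c₀) (c₁ := c₁) hpos₁ f)) (bd, μ)‖ ≤ K * α * F := by
  classical
  obtain ⟨α₀, K, κ, hα₀, hK, hκ, H⟩ :=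
    exists_gradLetter_G1k_sub_flat hd L hL hL3 φ hMφ hMφ' hφ hφ' hstar ha ha' hr0 hr1 τ hτ hCτ hτm hMτ hρw hτ₁ hτ₂ hφτ b hM₂ hrepr AQ
  set S : ℝ := latticeConst d κ with hS
  have hS0 : 0 ≤ S := latticeConst_nonneg d hκ.le
  refine ⟨α₀, K * S, hα₀, mul_nonneg hK hS0, ?_⟩
  intro n η hηL c₀ c₁ _ _ hw hρ m _ hm U α hα hαle hUb hUη hUw hpl hUst αU hα0U hα1 hAQ hU1 hreg εU hε0 hε1 hεr hlev hlev1 hRlev hposU' hposU hpos'₁ hpos₁ f F hfF μ bd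
  have hF : 0 ≤ F := (norm_nonneg _).trans (hfF bd)
  set piB : Bond d (towerP L m (n + 1)) → TSite d m := fun b' => blockCoord (L ^ (n + 1)) m (siteCast (towerP_eq_fineP_pow L m (n + 1)) (bpos b')) with hpiB
  set piT : Bond d (towerP L m (n + 1)) → TSite d m := fun b' => blockCoord (L ^ (n + 1)) m (siteCast (towerP_eq_fineP_pow L m (n + 1)) (btgt b')) with hpiT
  set GU := G1k L m n φ η U hL αU hα1 hU1 hreg τ (c₀ := c₀) (c₁ := c₁) hposU with hGU
  set G1 := G1k L m n φ η (fun _ : Bond d (towerP L m (n + 1)) => (1 : 𝔸ˣ)) hL (fun _ => 0) (fun _ => by norm_num)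
    (perCfg_UlevOf_one_mem_U1 L m (n + 1)) (norm_Wcx_UlevOf_one_sub_one_le L m (n + 1) (fun _ => 0) (fun _ => le_rfl)) τ (c₀ := c₀) (c₁ := c₁) hpos₁ with hG1
  -- the block decomposition of the source
  obtain ⟨P, hP⟩ := exists_block_clm_family (𝕜 := ℂ) (w := fun _ : Bond d (towerP L m (n + 1)) => c₀) (V := W) piB
  have hdec : GU f - G1 f = ∑ v, (GU (P v f) - G1 (P v f)) := by
    conv_lhs => rw [← sum_block_apply hP f]
    rw [map_sum, map_sum, Finset.sum_sub_distrib]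
  have hfun : WL2.equiv ℂ (fun _ : Bond d (towerP L m (n + 1)) => c₀) W (GU f - G1 f) =
      ∑ v, WL2.equiv ℂ (fun _ : Bond d (towerP L m (n + 1)) => c₀) W (GU (P v f) - G1 (P v f)) := by
    rw [hdec]
    have e := map_sum (WL2.linearEquiv ℂ ℂ (fun _ : Bond d (towerP L m (n + 1)) => c₀) (V := W))
      (fun v => GU (P v f) - G1 (P v f)) Finset.univ
    simpa only [WL2.linearEquiv_apply] using e
  -- each block source obeys the letter, in both readings
  have hblk : ∀ v, (∀ b', piB b' ≠ v → WL2.equiv ℂ (fun _ : Bond d (towerP L m (n + 1)) => c₀) W (P v f) b' = 0) ∧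
      (∀ b', ‖WL2.equiv ℂ (fun _ : Bond d (towerP L m (n + 1)) => c₀) W (P v f) b'‖ ≤ F) := by
    intro v
    refine ⟨fun b' hb' => ?_, fun b' => ?_⟩
    · rw [hP, if_neg hb']
    · rw [hP]
      split_ifs
      · exact hfF b'
      · rw [norm_zero]; exact hF
  have hsum : ∀ (R : Bond d (towerP L m (n + 1)) → W →ₗ[ℂ] W),
      (∀ v, ‖covGrad ((η : ℂ))⁻¹ R (WL2.equiv ℂ (fun _ : Bond d (towerP L m (n + 1)) => c₀) W (GU (P v f) - G1 (P v f))) (bd, μ)‖ ≤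
        K * α * Real.exp (-(κ * tdist m (piT bd) v)) * F) →
      ‖covGrad ((η : ℂ))⁻¹ R (WL2.equiv ℂ (fun _ : Bond d (towerP L m (n + 1)) => c₀) W (GU f - G1 f)) (bd, μ)‖ ≤ K * S * α * F := by
    intro R hR
    rw [hfun, map_sum, Finset.sum_apply]
    calc ‖∑ v, covGrad ((η : ℂ))⁻¹ R (WL2.equiv ℂ (fun _ : Bond d (towerP L m (n + 1)) => c₀) W (GU (P v f) - G1 (P v f))) (bd, μ)‖
        ≤ ∑ v, ‖covGrad ((η : ℂ))⁻¹ R (WL2.equiv ℂ (fun _ : Bond d (towerP L m (n + 1)) => c₀) W (GU (P v f) - G1 (P v f))) (bd, μ)‖ := norm_sum_le _ _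
      _ ≤ ∑ v, K * α * Real.exp (-(κ * tdist m (piT bd) v)) * F := Finset.sum_le_sum fun v _ => hR v
      _ = K * α * F * ∑ v, Real.exp (-(κ * tdist m (piT bd) v)) := by
          rw [Finset.mul_sum]; exact Finset.sum_congr rfl fun v _ => by ring
      _ ≤ K * α * F * S := mul_le_mul_of_nonneg_left (torusSum_le d hm hκ (piT bd)) (by positivity)
      _ = K * S * α * F := by ring
  refine ⟨hsum _ fun v => ?_, hsum _ fun v => ?_⟩
  · exact (H n η hηL c₀ c₁ hw hρ m hm U α hα hαle hUb hUη hUw hpl hUst αU hα0U hα1 hAQ hU1 hreg εU hε0 hε1 hεr hlev hlev1 hRlev hposU' hposU hpos'₁ hpos₁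
      v (P v f) F (hblk v).1 (hblk v).2 μ bd).2.1
  · exact (H n η hηL c₀ c₁ hw hρ m hm U α hα hαle hUb hUη hUw hpl hUst αU hα0U hα1 hAQ hU1 hreg εU hε0 hε1 hεr hlev hlev1 hRlev hposU' hposU hpos'₁ hpos₁
      v (P v f) F (hblk v).1 (hblk v).2 μ bd).2.2

end Literature.MathematicalPhysics.QuantumFieldTheory.Balaban1983to89.B9Eq386BondPropagatorTwoBackgroundGradientLetterTower

end
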